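/-
Copyright (c) 2026 the pub-hodgecm-mathlib formalisation cell (harness21).  Prover seat hodgecm-mathlib-K2Liu-p03 (g6): Track B «K2-LIT»,
#184♮ = hLiu418 = stmt-HodgeConjecture-24832, road `K2_Liu`, Road I organ (A-int)-fin, A7-reg (GK COCYCLE road): K2Liu-p09 (g5) ASK-R (R1)–(R4)
2026-09-04T09:12:36Z, LEAD F0P6-plan (g13) RULING «M-157m» (2) ∕ 09:14:34Z «ASK-R FIRST».
-/
import Literature.NumberTheory.Automorphic.QuadraticLocalBaseChange      -- ★ `UnitaryGroup.LocalRing E v = Π_{w ∣ v} E_w`, `PlacesOver.nonempty`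
import Literature.NumberTheory.Automorphic.UnitaryGroupSplitPlace         -- ★ `PlacesOver.eq_or_eq_galInv`, `PlacesOver.galInv_ne`
import Literature.NumberTheory.Automorphic.Liu2021.Def411IrreducibleOfLemD1AsPrinted   -- ★ `UnitaryGroup.algEquiv_ne_one_of_apply_eq_neg` (`c δ = −δ ≠ 0 ⇒ c ≠ 1`)
import Mathlib.MeasureTheory.Measure.Haar.Unique
import HarnessLib

/-!
# Crux `HLiu418`, road `K2_Liu`, organ (A-int)-fin, A7-reg: `E ⊗ F_v = Π_{w ∣ v} E_w` HAS ONE OR TWO FACTORS — the additive homeomorphisms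
# `E_w ≃ₜ E ⊗ F_v` (non-split) and `E_{w₁} × E_{w₂} ≃ₜ E ⊗ F_v` (split), and Haar uniqueness along an additive homeomorphism

Cell `hodgecm-mathlib`, crux item hLiu418 = `stmt-HodgeConjecture-24832`; squad K2 ∕ K2Liu; prover K2Liu-p03 (g6).  THEOREMS ONLY (no `def`, no instance,
no notation, no named-fact hypothesis, no `sorry`); lane `--supports stmt-HodgeConjecture-24832 --as helper`.  Generic quadratic datum `(F, E, c, v)`.
The stage-B step of the A7-reg cocycle (★ B4d-2 `K2LiuSiegelCocycleStepShort`, B7-B: the `GL₂`-type rank-one operator integrates over `R = E ⊗ F_v = Π_{w ∣ v} E_w`)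
splits `∫_R` into one or two integrals over the completions `E_w`; these are the carriers (K2Liu-p09 (g5)'s shapes (R1)–(R4) verbatim):
* §1 (R1) **`placesOver_cases`**: over a quadratic `E/F` (`c ≠ 1`) the fibre `PlacesOver E v` is `{w}` or `{w₁, w₂}` with `w₁ ≠ w₂` (★ `PlacesOver.eq_or_eq_galInv`:
  the places above `v` are `w` and `c⁻¹ • w`); `placesOver_cases'` reads `c ≠ 1` off `c δ = −δ ≠ 0` (★ `algEquiv_ne_one_of_apply_eq_neg`).
* §2 (R2) **`exists_homeomorph_single_of_forall_eq`**: if `w` is the only place above `v`, `ζ ↦ Pi.single w ζ` is an additive homeomorphism `E_w ≃ₜ Π_{w′} E_{w′}`.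
* §3 (R3) **`exists_homeomorph_single_add_single`**: if the places above `v` are `w₁ ≠ w₂`, `(ζ₁, ζ₂) ↦ Pi.single w₁ ζ₁ + Pi.single w₂ ζ₂` is an additive homeomorphism
  `E_{w₁} × E_{w₂} ≃ₜ Π_{w′} E_{w′}`.  (`Pi.single` is stated under an instance binder `[DecidableEq (PlacesOver E v)]`, so any call-site instance unifies.)
* §4 (R4) **`exists_addHaar_eq_smul_map`**: for an additive homeomorphism `e : A ≃ₜ R` of second-countable locally compact abelian groups and additive Haar measures `μA`,
  `μR`: `μR = c • map e μA` for some `0 < c < ∞` (Mathlib `AddEquiv.isAddHaarMeasure_map` + `Measure.isAddLeftInvariant_eq_smul`; the pattern of ★ B4d-3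
  `exists_measure_eq_smul_map`).
HONEST LABEL.  Count-neutral helper: `HC_CM` is proved only modulo the 7 printed citations (2 remaining named inputs: hLiu418 = `stmt-HodgeConjecture-24832`,
h413 = `stmt-HodgeConjecture-24833`) until rung 0 closes.

## References
* [CasselsFrohlichANT1967] J. W. S. Cassels, A. Fröhlich (eds.), *Algebraic Number Theory* (1967): Ch. II §10–§11 (`L ⊗_K K_v = ∏_{w ∣ v} L_w`), Ch. VII Prop. 1.2 (ii).
* [Weil1965] A. Weil, *L'intégration dans les groupes topologiques* (1965): §37 (uniqueness of Haar measure; transport along an isomorphism).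
* [TateThesis1967] J. Tate, *Fourier analysis in number fields* (Cassels–Fröhlich Ch. XV): §2.2 (local additive Haar measures).
-/

set_option autoImplicit false
set_option linter.dupNamespace false -- the mandated namespace repeats `HodgeConjecture.HodgeConjecture`

noncomputable section

open NumberField IsDedekindDomain MeasureTheory Topology
open scoped NNReal ENNReal
open Literature.NumberTheory.Automorphic Literature.NumberTheory.Automorphic.UnitaryGroup

namespace Summit.HodgeConjecture.HodgeConjecture.Cruxes.HLiu418.K2LiuLocalRingPlaceDecomposition

variable (F : Type) [Field F] [NumberField F] (E : Type) [Field E] [NumberField E] [Algebra F E] (c : E ≃ₐ[F] E) (v : HeightOneSpectrum (𝓞 F))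

/-! ## §1 (R1) one or two places above `v` -/

/-- **(R1) the places of `E` above `v` are ONE place `w` (every `w′ = w`) or TWO distinct places `w₁ ≠ w₂` (every `w′ ∈ {w₁, w₂}`)** — quadratic `E/F`, `c ≠ 1`;
the second place is `c⁻¹ • w` (★ `PlacesOver.eq_or_eq_galInv`). [cite: CasselsFrohlichANT1967, Ch. VII Prop. 1.2 (ii)] -/
theorem placesOver_cases [Algebra.IsQuadraticExtension F E] (hc : c ≠ 1) :
    (∃ w : PlacesOver E v, ∀ w' : PlacesOver E v, w' = w) ∨
      ∃ w₁ w₂ : PlacesOver E v, w₁ ≠ w₂ ∧ ∀ w' : PlacesOver E v, w' = w₁ ∨ w' = w₂ := by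
  obtain ⟨w⟩ := (inferInstance : Nonempty (PlacesOver E v))
  by_cases hw : c • w.1 = w.1
  · refine Or.inl ⟨w, fun w' => ?_⟩
    rcases PlacesOver.eq_or_eq_galInv c hc w w' with h | h
    · exact h
    · rw [h]
      exact Subtype.ext ((inv_smul_eq_iff).2 hw.symm)
  · exact Or.inr ⟨w, PlacesOver.galInv c w, (PlacesOver.galInv_ne c w hw).symm, fun w' => PlacesOver.eq_or_eq_galInv c hc w w'⟩

/-- (R1) with `c ≠ 1` read off `c δ = −δ ≠ 0` (the K2Liu datum; ★ `UnitaryGroup.algEquiv_ne_one_of_apply_eq_neg`). [cite: CasselsFrohlichANT1967, Ch. VII Prop. 1.2 (ii)] -/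
theorem placesOver_cases' [Algebra.IsQuadraticExtension F E] {δ : E} (hcδ : c δ = -δ) (hδ : δ ≠ 0) :
    (∃ w : PlacesOver E v, ∀ w' : PlacesOver E v, w' = w) ∨
      ∃ w₁ w₂ : PlacesOver E v, w₁ ≠ w₂ ∧ ∀ w' : PlacesOver E v, w' = w₁ ∨ w' = w₂ :=
  placesOver_cases F E c v (Literature.NumberTheory.Automorphic.UnitaryGroup.algEquiv_ne_one_of_apply_eq_neg F E c hcδ hδ)

/-! ## §2 (R2) the non-split factorisation `E_w ≃ₜ E ⊗ F_v` -/

omit [NumberField F] in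
/-- **(R2) at a NON-SPLIT place (`w` the only place above `v`) `ζ ↦ Pi.single w ζ` is an ADDITIVE HOMEOMORPHISM `E_w ≃ₜ E ⊗ F_v = Π_{w′ ∣ v} E_{w′}`** (inverse:
evaluation at `w`). [cite: CasselsFrohlichANT1967, Ch. II §10–§11] -/
theorem exists_homeomorph_single_of_forall_eq [DecidableEq (PlacesOver E v)] (w : PlacesOver E v) (hw : ∀ w' : PlacesOver E v, w' = w) :
    ∃ e₁ : w.1.adicCompletion E ≃ₜ UnitaryGroup.LocalRing E v,
      (∀ ζ : w.1.adicCompletion E, e₁ ζ = Pi.single w ζ) ∧ ∀ ζ ζ' : w.1.adicCompletion E, e₁ (ζ + ζ') = e₁ ζ + e₁ ζ' := by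
  let eqv : w.1.adicCompletion E ≃ UnitaryGroup.LocalRing E v :=
    { toFun := fun ζ => Pi.single w ζ
      invFun := fun x => x w
      left_inv := fun ζ => by
        show (Pi.single w ζ : UnitaryGroup.LocalRing E v) w = ζ
        exact Pi.single_eq_same _ _
      right_inv := fun x => by
        funext w'
        rcases hw w' with rfl
        simp only [Pi.single_eq_same] }
  have hcont : Continuous fun ζ : w.1.adicCompletion E => (Pi.single w ζ : UnitaryGroup.LocalRing E v) := by
    refine continuous_pi fun j => ?_
    by_cases h : j = w
    · subst h; simp only [Pi.single_eq_same]; exact continuous_id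
    · simp only [Pi.single_eq_of_ne h]; exact continuous_const
  let e₁ : w.1.adicCompletion E ≃ₜ UnitaryGroup.LocalRing E v :=
    { toEquiv := eqv, continuous_toFun := hcont, continuous_invFun := continuous_apply w }
  refine ⟨e₁, fun ζ => rfl, fun ζ ζ' => ?_⟩
  show (Pi.single w (ζ + ζ') : UnitaryGroup.LocalRing E v) = (Pi.single w ζ : UnitaryGroup.LocalRing E v) + (Pi.single w ζ' : UnitaryGroup.LocalRing E v)
  exact (Pi.single_add (f := fun j : PlacesOver E v => j.1.adicCompletion E) w ζ ζ')

/-! ## §3 (R3) the split factorisation `E_{w₁} × E_{w₂} ≃ₜ E ⊗ F_v` -/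

omit [NumberField F] in
/-- **(R3) at a SPLIT place (places `w₁ ≠ w₂` above `v`, no others) `(ζ₁, ζ₂) ↦ Pi.single w₁ ζ₁ + Pi.single w₂ ζ₂` is an ADDITIVE HOMEOMORPHISM
`E_{w₁} × E_{w₂} ≃ₜ E ⊗ F_v`** (inverse: evaluation at `w₁`, `w₂`). [cite: CasselsFrohlichANT1967, Ch. II §10–§11] -/
theorem exists_homeomorph_single_add_single [DecidableEq (PlacesOver E v)] (w₁ w₂ : PlacesOver E v) (hne : w₁ ≠ w₂)
    (hw : ∀ w' : PlacesOver E v, w' = w₁ ∨ w' = w₂) :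
    ∃ e₂ : (w₁.1.adicCompletion E × w₂.1.adicCompletion E) ≃ₜ UnitaryGroup.LocalRing E v,
      (∀ (ζ₁ : w₁.1.adicCompletion E) (ζ₂ : w₂.1.adicCompletion E), e₂ (ζ₁, ζ₂) = Pi.single w₁ ζ₁ + Pi.single w₂ ζ₂) ∧
      ∀ p p' : w₁.1.adicCompletion E × w₂.1.adicCompletion E, e₂ (p + p') = e₂ p + e₂ p' := by
  have h21 : w₂ ≠ w₁ := fun h => hne h.symm
  let eqv : (w₁.1.adicCompletion E × w₂.1.adicCompletion E) ≃ UnitaryGroup.LocalRing E v :=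
    { toFun := fun p => Pi.single w₁ p.1 + Pi.single w₂ p.2
      invFun := fun x => (x w₁, x w₂)
      left_inv := fun p => by
        ext
        · simp only [Pi.add_apply, Pi.single_eq_same, Pi.single_eq_of_ne hne, add_zero]
        · simp only [Pi.add_apply, Pi.single_eq_same, Pi.single_eq_of_ne h21, zero_add]
      right_inv := fun x => by
        funext w'
        rcases hw w' with rfl | rfl
        · simp only [Pi.add_apply, Pi.single_eq_same, Pi.single_eq_of_ne hne, add_zero]
        · simp only [Pi.add_apply, Pi.single_eq_same, Pi.single_eq_of_ne h21, zero_add] }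
  have hsingle : ∀ w : PlacesOver E v, Continuous fun ζ : w.1.adicCompletion E => (Pi.single w ζ : UnitaryGroup.LocalRing E v) := fun w => by
    refine continuous_pi fun j => ?_
    by_cases h : j = w
    · subst h; simp only [Pi.single_eq_same]; exact continuous_id
    · simp only [Pi.single_eq_of_ne h]; exact continuous_const
  have h1 : Continuous fun p : w₁.1.adicCompletion E × w₂.1.adicCompletion E => (Pi.single w₁ p.1 : UnitaryGroup.LocalRing E v) :=
    (hsingle w₁).comp continuous_fst
  have h2 : Continuous fun p : w₁.1.adicCompletion E × w₂.1.adicCompletion E => (Pi.single w₂ p.2 : UnitaryGroup.LocalRing E v) :=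
    (hsingle w₂).comp continuous_snd
  let e₂ : (w₁.1.adicCompletion E × w₂.1.adicCompletion E) ≃ₜ UnitaryGroup.LocalRing E v :=
    { toEquiv := eqv, continuous_toFun := h1.add h2, continuous_invFun := (continuous_apply w₁).prodMk (continuous_apply w₂) }
  refine ⟨e₂, fun ζ₁ ζ₂ => rfl, fun p p' => ?_⟩
  show (Pi.single w₁ (p + p').1 + Pi.single w₂ (p + p').2 : UnitaryGroup.LocalRing E v) =
    (Pi.single w₁ p.1 + Pi.single w₂ p.2 : UnitaryGroup.LocalRing E v) + (Pi.single w₁ p'.1 + Pi.single w₂ p'.2 : UnitaryGroup.LocalRing E v)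
  rw [Prod.fst_add, Prod.snd_add, Pi.single_add, Pi.single_add, add_add_add_comm]

/-! ## §4 (R4) Haar uniqueness along an additive homeomorphism -/

/-- **(R4) HAAR TRANSPORT**: for an additive homeomorphism `e : A ≃ₜ R` between second-countable locally compact abelian groups and additive Haar measures `μA` on `A`,
`μR` on `R`, there is `0 < c` (finite) with `μR = c • map e μA` (the push-forward of a Haar measure along a topological isomorphism is a Haar measure; Haar measures are
proportional). [cite: Weil1965, §37] [cite: TateThesis1967, §2.2] -/
theorem exists_addHaar_eq_smul_map {A R : Type*} [AddCommGroup A] [TopologicalSpace A] [IsTopologicalAddGroup A] [MeasurableSpace A] [BorelSpace A]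
    [AddCommGroup R] [TopologicalSpace R] [IsTopologicalAddGroup R] [MeasurableSpace R] [BorelSpace R] [LocallyCompactSpace R] [SecondCountableTopology R]
    (e : A ≃ₜ R) (hadd : ∀ p p' : A, e (p + p') = e p + e p')
    (μA : Measure A) [μA.IsAddHaarMeasure] (μR : Measure R) [μR.IsAddHaarMeasure] :
    ∃ cR : ℝ≥0, 0 < cR ∧ μR = (cR : ℝ≥0∞) • Measure.map e.toMeasurableEquiv μA := by
  set eA : A ≃+ R := { toFun := e, invFun := e.symm, left_inv := e.symm_apply_apply, right_inv := e.apply_symm_apply, map_add' := hadd } with heA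
  haveI : (Measure.map eA μA).IsAddHaarMeasure := AddEquiv.isAddHaarMeasure_map μA eA e.continuous e.symm.continuous
  have hmap : Measure.map e.toMeasurableEquiv μA = Measure.map eA μA := by rw [Homeomorph.toMeasurableEquiv_coe]; rfl
  have hsmul := Measure.isAddLeftInvariant_eq_smul μR (Measure.map eA μA)
  refine ⟨μR.addHaarScalarFactor (Measure.map eA μA), Measure.addHaarScalarFactor_pos_of_isAddHaarMeasure _ _, ?_⟩
  rw [hmap, ← ENNReal.smul_def]
  exact hsmul

end Summit.HodgeConjecture.HodgeConjecture.Cruxes.HLiu418.K2LiuLocalRingPlaceDecomposition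

end
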